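import Summits.ValiantsHypothesis.ValiantsHypothesis.Theorems.SymPencilHomogeneousDropRankCodim
import Summits.ValiantsHypothesis.ValiantsHypothesis.Theorems.SymPencilHomogeneousHessianRank

/-!
# Route `SymPencil` — kernel-fixed symmetric pencils: `rank A₀ ≤ 2 · codim (kernel rows)`
# (structural lemma toward the crux `SdcSuperquadratic`, stmt-ValiantsHypothesis-5674)

Codimension-`c` form of `SymPencilKernelFixedRank.rank_le_two_of_kernelRow` (the case `c = 1`):
for a symmetric corank-`1` matrix `Y` with kernel vector `w`, a symmetric `A₀` with `A₀ w = 0`, and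
a linear family `M` of symmetric matrices satisfying the homogeneity identity
`det (Y + M v + ν A₀) = (1 + ν) ^ j det (Y + M v)`, if the kernel-row map `v ↦ M(v) w` takes a
value `u` with `w ⬝ u ≠ 0` and its image contains a subspace `R`, then
`rank A₀ + 2 dim R ≤ 2 |ι|`, i.e. `rank A₀ ≤ 2 codim R`
(`rank_add_two_mul_finrank_le_of_kernelRow`).  The proof conjugates by the matrix `P` with first
column `w` exactly as in the rank-two file, pulls `R` back to the corner-`0` columns
(`finrank_add_le_finrank_comap_add`: an injective linear map loses at most `codim` of a
subspace under pull-back), and applies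
`SymPencilHomogeneousDropRankCodim.rank_add_two_mul_finrank_le_of_det_add_smul`. [folklore]
-/

noncomputable section

-- single-conjunct layout: Sub = Summit, duplicated namespace component intended
set_option linter.dupNamespace false

namespace Summit.ValiantsHypothesis.ValiantsHypothesis.Theorems.SymPencilKernelFixedRankCodim

open Matrix MvPolynomial
open Literature.Computability.AlgebraicComplexity
open Summit.ValiantsHypothesis.ValiantsHypothesis.Theorems.SymPencilHomogeneousDropTools
open Summit.ValiantsHypothesis.ValiantsHypothesis.Theorems.SymPencilHomogeneousDropRankCodim

universe u

variable {k : Type u} [Field k]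

/-! ### Pull-back of a subspace under an injective linear map -/

/-- **An injective linear map loses at most the codimension under pull-back**: for `J : V → W`
injective and `R ≤ W`, `dim R + dim V ≤ dim (J⁻¹ R) + dim W`. [folklore] -/
theorem finrank_add_le_finrank_comap_add {V W : Type*} [AddCommGroup V] [Module k V]
    [AddCommGroup W] [Module k W] [FiniteDimensional k W]
    (J : V →ₗ[k] W) (hJ : Function.Injective J) (R : Submodule k W) :
    Module.finrank k R + Module.finrank k V ≤
      Module.finrank k (Submodule.comap J R) + Module.finrank k W := by
  haveI : FiniteDimensional k V := Module.Finite.of_injective J hJ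
  have h1 : Module.finrank k (Submodule.comap J R) =
      Module.finrank k ↥(LinearMap.range J ⊓ R) := by
    rw [← Submodule.map_comap_eq,
      (Submodule.equivMapOfInjective J hJ (Submodule.comap J R)).finrank_eq]
  have h2 : Module.finrank k (LinearMap.range J) = Module.finrank k V :=
    LinearMap.finrank_range_of_inj hJ
  have h3 := Submodule.finrank_sup_add_finrank_inf_eq (LinearMap.range J) R
  have h4 : Module.finrank k ↥(LinearMap.range J ⊔ R) ≤ Module.finrank k W :=
    Submodule.finrank_le _
  omega

variable [CharZero k] {V : Type*} [AddCommGroup V] [Module k V]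

/-- **Bridge, split index, kernel-fixed case, codimension `c`.** [folklore] -/
theorem rank_add_two_mul_finrank_le_of_kernelRow_sum {ι' : Type*} [Fintype ι'] [DecidableEq ι']
    (Y A₀ : Matrix (Unit ⊕ ι') (Unit ⊕ ι') k) (hYs : Yᵀ = Y) (hA₀s : A₀ᵀ = A₀)
    (w : Unit ⊕ ι' → k) (hw0 : w (Sum.inl ()) ≠ 0) (hYw : Y *ᵥ w = 0) (hA₀w : A₀ *ᵥ w = 0)
    (hrank : Fintype.card ι' ≤ Y.rank) (M : V →ₗ[k] Matrix (Unit ⊕ ι') (Unit ⊕ ι') k)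
    (hMs : ∀ v, (M v)ᵀ = M v) (j : ℕ)
    (hH : ∀ (v : V) (ν : k), ν ≠ -1 → (Y + M v + ν • A₀).det = (1 + ν) ^ j * (Y + M v).det)
    (h1 : ∃ v, w ⬝ᵥ M v *ᵥ w ≠ 0)
    (R : Submodule k (Unit ⊕ ι' → k)) (hR : ∀ z ∈ R, ∃ v, M v *ᵥ w = z) :
    A₀.rank + 2 * Module.finrank k R ≤ 2 * Fintype.card ι' + 2 := by
  classical
  -- the congruence matrix `P` with first column `w` (as in the surjective bridge)
  set P : Matrix (Unit ⊕ ι') (Unit ⊕ ι') k := Matrix.fromBlocks (w (Sum.inl ()) • 1) 0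
    (Matrix.replicateCol Unit fun i => w (Sum.inr i)) 1 with hPdef
  have hPcol : ∀ b, P b (Sum.inl ()) = w b := by
    rintro (b | b)
    · simp [hPdef]
    · simp [hPdef]
  have hPinr : ∀ (b : Unit ⊕ ι') (j : ι'), P b (Sum.inr j) = if b = Sum.inr j then 1 else 0 := by
    rintro (b | b) j
    · simp [hPdef]
    · simp [hPdef, Matrix.one_apply]
  have hPdet : P.det = w (Sum.inl ()) := by
    rw [hPdef, Matrix.det_fromBlocks_zero₁₂, Matrix.det_one, mul_one, Matrix.det_smul,
      Matrix.det_one, mul_one, Fintype.card_unit, pow_one]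
  have hPu : IsUnit P.det := isUnit_iff_ne_zero.2 (by rw [hPdet]; exact hw0)
  have hPtu : IsUnit Pᵀ.det := by rwa [Matrix.det_transpose]
  have hcol : ∀ (N : Matrix (Unit ⊕ ι') (Unit ⊕ ι') k) (i : Unit ⊕ ι'),
      (Pᵀ * N * P) i (Sum.inl ()) = (Pᵀ *ᵥ (N *ᵥ w)) i := by
    intro N i
    rw [Matrix.mulVec_mulVec, Matrix.mul_apply, Matrix.mulVec, dotProduct]
    simp_rw [hPcol]
  have hrow : ∀ (u : Unit ⊕ ι' → k), (Pᵀ *ᵥ u) (Sum.inl ()) = w ⬝ᵥ u := by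
    intro u
    simp only [Matrix.mulVec, dotProduct, Matrix.transpose_apply, hPcol]
  have hblock : ∀ (N : Matrix (Unit ⊕ ι') (Unit ⊕ ι') k) (i j : ι'),
      (Pᵀ * N * P) (Sum.inr i) (Sum.inr j) = N (Sum.inr i) (Sum.inr j) := by
    intro N i j
    simp only [Matrix.mul_apply, Matrix.transpose_apply, hPinr, ite_mul, one_mul, zero_mul,
      mul_ite, mul_one, mul_zero, Finset.sum_ite_eq', Finset.mem_univ, if_true]
  have hsymm : ∀ N : Matrix (Unit ⊕ ι') (Unit ⊕ ι') k, Nᵀ = N → (Pᵀ * N * P)ᵀ = Pᵀ * N * P := by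
    intro N hN
    rw [Matrix.transpose_mul, Matrix.transpose_mul, Matrix.transpose_transpose, hN,
      Matrix.mul_assoc]
  -- normal forms of `Y` and `A₀` (both kill `w`)
  have hnf : ∀ N : Matrix (Unit ⊕ ι') (Unit ⊕ ι') k, Nᵀ = N → N *ᵥ w = 0 →
      Pᵀ * N * P = Matrix.fromBlocks 0 0 0 N.toBlocks₂₂ := by
    intro N hN hNw
    have hc : ∀ i, (Pᵀ * N * P) i (Sum.inl ()) = 0 := fun i => by
      rw [hcol, hNw, Matrix.mulVec_zero, Pi.zero_apply]
    ext (i | i) (j | j)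
    · rw [hc]; simp
    · have h := hc (Sum.inr j)
      rw [← hsymm N hN, Matrix.transpose_apply] at h
      rw [h]; simp
    · rw [hc]; simp
    · rw [hblock]; simp [Matrix.toBlocks₂₂]
  set Δ : Matrix ι' ι' k := Y.toBlocks₂₂ with hΔdef
  set E : Matrix ι' ι' k := A₀.toBlocks₂₂ with hEdef
  have hYnf : Pᵀ * Y * P = Matrix.fromBlocks 0 0 0 Δ := hnf Y hYs hYw
  have hAnf : Pᵀ * A₀ * P = Matrix.fromBlocks 0 0 0 E := hnf A₀ hA₀s hA₀w
  have hbs : ∀ N : Matrix (Unit ⊕ ι') (Unit ⊕ ι') k, Nᵀ = N → (N.toBlocks₂₂)ᵀ = N.toBlocks₂₂ := by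
    intro N hN
    ext i j
    simp only [Matrix.toBlocks₂₂, Matrix.transpose_apply, Matrix.of_apply]
    rw [← hN, Matrix.transpose_apply, hN]
  have hΔs : Δᵀ = Δ := hbs Y hYs
  have hEs : Eᵀ = E := hbs A₀ hA₀s
  -- `rank (0 ⊕ X) ≤ rank X` and `rank (Pᵀ X P) = rank X`
  have hr0 : ∀ X : Matrix ι' ι' k,
      (Matrix.fromBlocks (0 : Matrix Unit Unit k) 0 0 X).rank ≤ X.rank := by
    intro X
    have hf : Matrix.fromBlocks (0 : Matrix Unit Unit k) 0 0 X =
        Matrix.fromRows (0 : Matrix Unit ι' k) (1 : Matrix ι' ι' k) * X *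
          Matrix.fromCols (0 : Matrix ι' Unit k) (1 : Matrix ι' ι' k) := by
      rw [Matrix.fromRows_mul, Matrix.fromRows_mul_fromCols]
      simp
    rw [hf]
    exact (Matrix.rank_mul_le_left _ _).trans (Matrix.rank_mul_le_right _ _)
  have hrP : ∀ X : Matrix (Unit ⊕ ι') (Unit ⊕ ι') k, (Pᵀ * X * P).rank = X.rank := fun X => by
    rw [Matrix.rank_mul_eq_left_of_isUnit_det _ _ hPu,
      Matrix.rank_mul_eq_right_of_isUnit_det _ _ hPtu]
  -- `Δ` is invertible
  have hΔ : IsUnit Δ.det := by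
    rw [isUnit_iff_ne_zero]
    intro hΔ0
    have hlt := Matrix.rank_lt_card_of_det_eq_zero hΔ0
    have h2 := hr0 Δ
    rw [← hYnf, hrP] at h2
    omega
  -- the transported family
  let M' : V →ₗ[k] Matrix (Unit ⊕ ι') (Unit ⊕ ι') k :=
    { toFun := fun v => Pᵀ * M v * P
      map_add' := fun v₁ v₂ => by simp only [map_add, Matrix.mul_add, Matrix.add_mul]
      map_smul' := fun c v => by
        simp only [map_smul, Matrix.mul_smul, Matrix.smul_mul, RingHom.id_apply] }
  have hM' : ∀ v, M' v = Pᵀ * M v * P := fun v => rfl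
  -- the corner-`0` columns: pull `R` back along `b ↦ (Pᵀ)⁻¹ (0, b)`
  let J : (ι' → k) →ₗ[k] (Unit ⊕ ι' → k) :=
    { toFun := fun b => (Pᵀ)⁻¹ *ᵥ Sum.elim (fun _ => (0 : k)) b
      map_add' := fun b c => by
        rw [← Matrix.mulVec_add]
        congr 1
        ext (i | i) <;> simp
      map_smul' := fun c b => by
        rw [RingHom.id_apply, ← Matrix.mulVec_smul]
        congr 1
        ext (i | i) <;> simp }
  have hJ : ∀ b, J b = (Pᵀ)⁻¹ *ᵥ Sum.elim (fun _ => (0 : k)) b := fun b => rfl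
  have hPJ : ∀ b, Pᵀ *ᵥ J b = Sum.elim (fun _ => (0 : k)) b := fun b => by
    rw [hJ, Matrix.mulVec_mulVec, Matrix.mul_nonsing_inv _ hPtu, Matrix.one_mulVec]
  have hJinj : Function.Injective J := by
    intro b c hbc
    have h := congr_arg (fun z => Pᵀ *ᵥ z) hbc
    simp only [hPJ] at h
    ext i
    have := congr_fun h (Sum.inr i)
    simpa using this
  set S : Submodule k (ι' → k) := Submodule.comap J R with hSdef
  have hSR : Module.finrank k R ≤ Module.finrank k S + 1 := by
    have h := finrank_add_le_finrank_comap_add J hJinj R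
    rw [Module.finrank_fintype_fun_eq_card, Module.finrank_fintype_fun_eq_card,
      Fintype.card_sum, Fintype.card_unit] at h
    rw [hSdef]
    omega
  have hE2 : E.rank + 2 * Module.finrank k S ≤ 2 * Fintype.card ι' := by
    refine rank_add_two_mul_finrank_le_of_det_add_smul Δ E hΔ hΔs hEs j M'
      (fun v => by rw [hM']; exact hsymm _ (hMs v)) (fun v ν hν => ?_) ?_ S (fun b hb => ?_)
    · -- the identity, conjugated by `P`
      rw [hM', ← hYnf, ← hAnf]
      have e1 : Pᵀ * Y * P + Pᵀ * M v * P + ν • (Pᵀ * A₀ * P) = Pᵀ * (Y + M v + ν • A₀) * P := by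
        simp only [Matrix.mul_add, Matrix.add_mul, Matrix.mul_smul, Matrix.smul_mul]
      have e2 : Pᵀ * Y * P + Pᵀ * M v * P = Pᵀ * (Y + M v) * P := by
        simp only [Matrix.mul_add, Matrix.add_mul]
      rw [e1, e2, Matrix.det_mul, Matrix.det_mul, Matrix.det_mul, Matrix.det_mul, hH v ν hν]
      ring
    · -- a direction with corner `1`
      obtain ⟨v₁, hv₁⟩ := h1
      refine ⟨(w ⬝ᵥ M v₁ *ᵥ w)⁻¹ • v₁, ?_⟩
      rw [map_smul, Matrix.smul_apply, hM', hcol, hrow, smul_eq_mul, inv_mul_cancel₀ hv₁]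
    · -- the corner-`0` columns `(0, b)`, `b ∈ S`
      have hz : J b ∈ R := Submodule.mem_comap.1 hb
      obtain ⟨v, hv⟩ := hR (J b) hz
      have hfirst : ∀ i, M' v i (Sum.inl ()) = Sum.elim (fun _ => (0 : k)) b i := by
        intro i
        rw [hM', hcol, hv, hPJ]
      exact ⟨v, hfirst _, fun i => hfirst _⟩
  have hA₀E : A₀.rank ≤ E.rank :=
    calc A₀.rank = (Pᵀ * A₀ * P).rank := (hrP A₀).symm
      _ = (Matrix.fromBlocks (0 : Matrix Unit Unit k) 0 0 E).rank := by rw [hAnf]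
      _ ≤ E.rank := hr0 E
  omega

/-- **Bridge, general index, kernel-fixed case, codimension `c`**: reindex through a coordinate
`i₀` with `w i₀ ≠ 0` and apply `rank_add_two_mul_finrank_le_of_kernelRow_sum`.  Conclusion:
`rank A₀ + 2 dim R ≤ 2 |ι|` whenever the image of the kernel-row map contains the subspace `R`.
[folklore] -/
theorem rank_add_two_mul_finrank_le_of_kernelRow {ι : Type*} [Fintype ι] [DecidableEq ι]
    (Y A₀ : Matrix ι ι k) (hYs : Yᵀ = Y) (hA₀s : A₀ᵀ = A₀) (w : ι → k) (hw : w ≠ 0)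
    (hYw : Y *ᵥ w = 0) (hA₀w : A₀ *ᵥ w = 0) (hrank : Fintype.card ι ≤ Y.rank + 1)
    (M : V →ₗ[k] Matrix ι ι k) (hMs : ∀ v, (M v)ᵀ = M v) (j : ℕ)
    (hH : ∀ (v : V) (ν : k), ν ≠ -1 → (Y + M v + ν • A₀).det = (1 + ν) ^ j * (Y + M v).det)
    (h1 : ∃ v, w ⬝ᵥ M v *ᵥ w ≠ 0)
    (R : Submodule k (ι → k)) (hR : ∀ z ∈ R, ∃ v, M v *ᵥ w = z) :
    A₀.rank + 2 * Module.finrank k R ≤ 2 * Fintype.card ι := by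
  classical
  obtain ⟨i₀, hi₀⟩ : ∃ i, w i ≠ 0 := Function.ne_iff.mp hw
  let e : ι ≃ Unit ⊕ {i // i ≠ i₀} :=
    { toFun := fun i => if h : i = i₀ then Sum.inl () else Sum.inr ⟨i, h⟩
      invFun := Sum.elim (fun _ => i₀) fun i => i.1
      left_inv := fun i => by
        by_cases h : i = i₀
        · simp [h]
        · simp [h]
      right_inv := by
        rintro (u | ⟨i, hi⟩)
        · simp
        · simp [hi] }
  have he0 : e.symm (Sum.inl ()) = i₀ := rfl
  set w' : Unit ⊕ {i // i ≠ i₀} → k := w ∘ e.symm with hw'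
  have hre : ∀ N : Matrix ι ι k, Matrix.reindex e e N *ᵥ w' = (N *ᵥ w) ∘ e.symm := by
    intro N
    rw [Matrix.reindex_apply, Matrix.submatrix_mulVec_equiv]
    have hwe : w' ∘ e.symm.symm = w := by
      ext i
      simp [hw']
    rw [hwe]
  have hdot : ∀ u : ι → k, w' ⬝ᵥ (u ∘ e.symm) = w ⬝ᵥ u := fun u => by
    rw [hw']
    exact Fintype.sum_equiv e.symm _ _ fun i => rfl
  let Rm : Matrix ι ι k →ₗ[k] Matrix (Unit ⊕ {i // i ≠ i₀}) (Unit ⊕ {i // i ≠ i₀}) k :=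
    (Matrix.reindexLinearEquiv k k e e).toLinearMap
  have hRm : ∀ N, Rm N = Matrix.reindex e e N := fun N => rfl
  -- the transported subspace of kernel rows
  let φ : (ι → k) ≃ₗ[k] (Unit ⊕ {i // i ≠ i₀} → k) := LinearEquiv.funCongrLeft k k e.symm
  have hφ : ∀ z : ι → k, φ z = z ∘ e.symm := fun z => rfl
  set R' : Submodule k (Unit ⊕ {i // i ≠ i₀} → k) := Submodule.map (φ : (ι → k) →ₗ[k] _) R
    with hR'def
  have hR'dim : Module.finrank k R' = Module.finrank k R := by
    rw [hR'def]
    exact LinearEquiv.finrank_map_eq φ R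
  have h := rank_add_two_mul_finrank_le_of_kernelRow_sum (Matrix.reindex e e Y)
    (Matrix.reindex e e A₀) (by rw [Matrix.transpose_reindex, hYs])
    (by rw [Matrix.transpose_reindex, hA₀s]) w'
    (by rw [hw', Function.comp_apply, he0]; exact hi₀)
    (by rw [hre, hYw]; rfl) (by rw [hre, hA₀w]; rfl) ?_ (Rm ∘ₗ M) (fun v => ?_) j
    (fun v ν hν => ?_) ?_ R' ?_
  · have hc : Fintype.card ι = Fintype.card (Unit ⊕ {i // i ≠ i₀}) := Fintype.card_congr e
    rw [Fintype.card_sum, Fintype.card_unit] at hc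
    rw [Matrix.rank_reindex, hR'dim] at h
    omega
  · have hc : Fintype.card ι = Fintype.card (Unit ⊕ {i // i ≠ i₀}) := Fintype.card_congr e
    rw [Fintype.card_sum, Fintype.card_unit] at hc
    rw [Matrix.rank_reindex]
    omega
  · rw [LinearMap.comp_apply, hRm, Matrix.transpose_reindex, hMs]
  · rw [LinearMap.comp_apply, hRm]
    have h := hH v ν hν
    simp only [Matrix.reindex_apply]
    have e3 : Y.submatrix e.symm e.symm + (M v).submatrix e.symm e.symm +
        ν • A₀.submatrix e.symm e.symm = (Y + M v + ν • A₀).submatrix e.symm e.symm := rfl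
    have e4 : Y.submatrix e.symm e.symm + (M v).submatrix e.symm e.symm =
        (Y + M v).submatrix e.symm e.symm := rfl
    rw [e3, e4, Matrix.det_submatrix_equiv_self, Matrix.det_submatrix_equiv_self, h]
  · obtain ⟨v, hv⟩ := h1
    exact ⟨v, by rw [LinearMap.comp_apply, hRm, hre, hdot]; exact hv⟩
  · intro z' hz'
    rw [hR'def, Submodule.mem_map] at hz'
    obtain ⟨z, hz, rfl⟩ := hz'
    obtain ⟨v, hv⟩ := hR z hz
    refine ⟨v, ?_⟩
    rw [LinearMap.comp_apply, hRm, hre, hv]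
    rfl

end Summit.ValiantsHypothesis.ValiantsHypothesis.Theorems.SymPencilKernelFixedRankCodim

end
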